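import Mathlib
import HarnessLib
import Literature.MathematicalPhysics.StatisticalMechanics.RenormalisationMapDecompositionFreeHt

/-!
# `K_{k+1}` with a free intermediate Hamiltonian as a sum of FOUR index families, LINEAR in the fluctuation integral
# ([ABKM19] Definition 6.5 (6.34) reblocked; the index split of Theorem 6.8 / Ch. 9.1 WITHOUT the first-order regrouping)

`RenormalisationMapDecompositionFreeHt.nextK_freeHt_eq_blockPart_add_remainders_abkm_of_stepKernelBounds` writes
`nextK(μ_D; e^{−H}, e^{−H̃}, K)(U) = blockPart + Σ₁(H̃) + Σ₂ᴸ(H̃) + Σ₃(H̃) + Σ₄(H̃) + Σ₀(H̃)`; the single-block terms `blockPart`,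
`Σ₁`, `Σ₀` contain the kernel NON-linearly (through `A_k = stepOpA (gradCov 𝒞)`, `B_kK` and the tied Hamiltonian
`H_{k+1} = A_kH + B_kK`), an artefact of adding and subtracting the first-order cancellation.  For a KERNEL SECOND
DIFFERENCE at a fixed `H̃` (block B4 of the `ℓ = 2` two-kernel slot (F4l2), [ABKM19] Lemma 12.6 (12.53)) one wants every
term AFFINE in the fluctuation integral `R = fluct D.𝒞`.  This file records the reblocked expansion (6.34) split only by
INDEX FAMILY — single blocks `B` with `B̄ = U` (inner family `X₁ ∈ {∅, B}`), large connected preimages, disconnected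
preimages (both with `X₁ ∈ {∅, X}` summed to `p_X(H̃)(R P₂(X) + (1 − e^{−H̃})^X)`), and the pairs `∅ ≠ X₁ ⊊ X`:

* **`nextK_freeHt_eq_four_abkm_of_stepKernelBounds`** — torus data with a kernel by predicate (`StepKernelBounds`),
  `‖H‖_{k,0} ≤ 1/8`, admissible `K` with `K(∅) = 1`, `U ≠ ∅`.

Every summand is `prefactor(H̃) × fluct D.𝒞 (P₂(e^{−H}, K)(X∖X₁))`, so second differences in the kernel are termwise.  The
three families with `X₁ ∈ {∅, X}` resp. `∅ ≠ X₁ ⊊ X` are literally the arguments of the kernel-only twins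
`RenormalisationMapRemainderTwoLargeKernelSecondDiff` / `RenormalisationMapRemaindersThreeFourKernelSecondDiff`.  Everything is
proved; no named fact.  Honest scope: block B4 of the stub `stub_f4l2ShrinkLoc` of the rung route
`Summits/HubbardSuperconductivity/…/Theses/ComplexGFFStiffness` (stiffness of a complex Gaussian gradient field via the [ABKM19]
RG); nothing about superconductivity in the Hubbard model is claimed.

## References
* S. Adams, S. Buchholz, R. Kotecký, S. Müller, arXiv:1910.13564, Definition 6.5 (6.34), Theorem 6.8, Ch. 9.1,
  Lemma 12.6 (12.53) [AdamsBuchholzKoteckyMuller2019].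
-/

noncomputable section

namespace Literature.MathematicalPhysics.StatisticalMechanics.GradientRG

open scoped BigOperators Classical
open Finset Matrix MeasureTheory
open Literature.MathematicalPhysics.StatisticalMechanics.TorusPolymer
  (IsPolymer blocks polys bprod blockOf thicken reblock boxCorner mem_polys mem_blocks numBlocks isPolymer_blockOf
    card_blocks_eq_numBlocks blocks_blockOf empty_mem_polys reblock_empty subset_thicken
    bprod_empty blocks_empty blocks_mono bprod_blockOf self_mem_polys)
open Literature.Barriers.CriticalPhenomena.LongRangePhi4.Polymer (IsConn components)
open Literature.MathematicalPhysics.QuantumFieldTheory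

variable {d M : ℕ} [NeZero M]

set_option maxHeartbeats 800000 in
/-- **`nextK(μ_{k+1}; e^{−H}, e^{−H̃}, K)(U)` as the sum of four index families, each term linear in `R = fluct D.𝒞`**
(module docstring): `d ≥ 2`, `L` odd, `M = L^N`, `k+1 ≤ N`, `⌊d/2⌋+1 ≤ min(p, M_ord)`, `δ₀, δ₁ > 0`, `h² ≥ h₀²`, `A > 0`;
step data `D` with `D.s = L^k`, `D.L = L` and `StepKernelBounds` for `D.𝒞`; `‖H‖_{k,0} ≤ 1/8`; `K` admissible with
`K(∅) = 1`; `U ≠ ∅`.  Then `nextK = Σ_{B̄ = U} Σ_{X₁ ∈ {∅,B}} t(B, X₁) + Σ_{X large} T(X) + Σ_{X disconnected} T(X)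
+ Σ_{π(X) = U} Σ_{∅ ≠ X₁ ⊊ X} t(X, X₁)` with `t(X, X₁) = p_X(H̃)(1−e^{−H̃})^{X₁} R P₂(X∖X₁)`, `T(X) = p_X(H̃)(R P₂(X) + (1−e^{−H̃})^X)`.
[cite: AdamsBuchholzKoteckyMuller2019, Definition 6.5 (6.34) / Theorem 6.8 / Ch. 9.1] -/
theorem nextK_freeHt_eq_four_abkm_of_stepKernelBounds {L N Mord R n p r₀ : ℕ}
    {θbar lam μ δ₁ δ₀ A𝒫 A𝒫' C₂ h A : ℝ}
    {𝒞 : ℕ → (Fin d → ZMod M) → ℝ} (hd : 2 ≤ d) (hLodd : Odd L)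
    (hM : M = L ^ N) {k : ℕ} (hkN : k + 1 ≤ N) (hp : d / 2 + 1 ≤ p) (hMord : d / 2 + 1 ≤ Mord)
    (hB : AbkmWeightBounds L N Mord R n θbar lam μ δ₁ δ₀ A𝒫 𝒞
      (abkmWeightData L N Mord R θbar (schedDelta δ₀ δ₁ N) 𝒞))
    (hδ₀ : 0 < δ₀) (hδ₁ : 0 < δ₁) (hh : 0 < h) (hh0 : hZeroSq d R δ₀ δ₁ ≤ h ^ 2) (hA : 0 < A)
    (D : StepData d M) (hDs : D.s = L ^ k) (hDL : D.L = L)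
    (hS : StepKernelBounds (abkmWeightData L N Mord R θbar (schedDelta δ₀ δ₁ N) 𝒞) L k A𝒫' C₂ D.𝒞)
    {H : RelevantHamiltonian ℂ d}
    (hH : hamNorm (fieldWt h (L : ℝ) d k) ((L : ℝ) ^ k) (L ^ (d * k)) H ≤ 1 / 8)
    (Ht : RelevantHamiltonian ℂ d)
    {K : Finset (Fin d → ZMod M) → ((Fin d → ZMod M) → ℝ) → ℂ} {C : ℝ} (hC : 0 ≤ C)
    (hK : WeakNormLE (abkmNormParams L N Mord R p r₀ h θbar A (schedDelta δ₀ δ₁ N) 𝒞) k K C)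
    (hKfac : Factorises (L ^ k) K) (hK0 : ∀ φ, K ∅ φ = 1) (hKd : ∀ Y, ContDiff ℝ r₀ (K Y))
    (hKloc : ∀ Y, IsPolymer (L ^ k) Y → IsConn Y →
      IsGaugeLocal ((abkmNormParams L N Mord R p r₀ h θbar A (schedDelta δ₀ δ₁ N) 𝒞).gauge k Y) (K Y))
    {U : Finset (Fin d → ZMod M)} (hUne : U.Nonempty) (φ : (Fin d → ZMod M) → ℝ) :
    nextK D.s (reblock D.s (D.L * D.s)) (stepMeasure D.𝒞) (expNegH H) (expNegH Ht) K U φ =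
      (∑ X ∈ (blocks (L ^ k) univ).filter (fun B => TorusPolymer.closure (L * L ^ k) B = U),
        ∑ X₁ ∈ ({∅, X} : Finset (Finset (Fin d → ZMod M))),
          bprod (L ^ k) (fun B => expNegH Ht B φ) (U \ X) * bprod (L ^ k) (fun B => expNegH (-Ht) B φ) (X \ U) *
            (bprod (L ^ k) (fun B => 1 - expNegH Ht B φ) X₁ * fluct D.𝒞 (polyP2 (L ^ k) H K (X \ X₁)) φ)) +
      (∑ X ∈ largePartIndex (L ^ k) L U,
        bprod (L ^ k) (fun B => expNegH Ht B φ) (U \ X) * bprod (L ^ k) (fun B => expNegH (-Ht) B φ) (X \ U) *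
          (fluct D.𝒞 (polyP2 (L ^ k) H K X) φ + bprod (L ^ k) (fun B => 1 - expNegH Ht B φ) X)) +
      (∑ X ∈ ((polys (L ^ k) univ).filter (fun X => reblock (L ^ k) (L * L ^ k) X = U)).filter
          (fun X => ¬ IsConn X),
        bprod (L ^ k) (fun B => expNegH Ht B φ) (U \ X) * bprod (L ^ k) (fun B => expNegH (-Ht) B φ) (X \ U) *
          (fluct D.𝒞 (polyP2 (L ^ k) H K X) φ + bprod (L ^ k) (fun B => 1 - expNegH Ht B φ) X)) +
      ∑ X ∈ (polys (L ^ k) univ).filter (fun X => reblock (L ^ k) (L * L ^ k) X = U),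
        ∑ X₁ ∈ ((polys (L ^ k) X).erase X).erase ∅,
          bprod (L ^ k) (fun B => expNegH Ht B φ) (U \ X) * bprod (L ^ k) (fun B => expNegH (-Ht) B φ) (X \ U) *
            (bprod (L ^ k) (fun B => 1 - expNegH Ht B φ) X₁ * fluct D.𝒞 (polyP2 (L ^ k) H K (X \ X₁)) φ) := by
  set P := abkmNormParams L N Mord R p r₀ h θbar A (schedDelta δ₀ δ₁ N) 𝒞 with hP
  have hL0 : (0 : ℝ) < L := by exact_mod_cast hLodd.pos
  have hk : k ≤ N := by omega
  have hMo : Odd M := by rw [hM]; exact hLodd.pow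
  have hsodd : Odd (L ^ k) := hLodd.pow
  have h𝔥 : 0 < fieldWt h (L : ℝ) d k := fieldWt_pos hh hL0 d k
  have hRk : (0 : ℝ) < (L : ℝ) ^ k := by positivity
  -- the step data is the concrete one: substitute its fields
  obtain ⟨s, L', 𝒸, c₀, B₀⟩ := D
  simp only at hDs hDL hS ⊢
  subst s L'
  -- integrability of `P₂(Z, φ + ·)`
  have hint : ∀ Z, IsPolymer (L ^ k) Z →
      Integrable (fun ξ => polyP2 (L ^ k) H K Z (φ + ξ)) (stepMeasure 𝒸) := by
    intro Z hZ
    have hb := tayNormLE_polyP2_abkm (p := p) (r₀ := r₀) hd hLodd hM hkN hp hMord hB hδ₀ hδ₁ hh hh0 hA hZ hH hC hK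
      hKfac hK0 hKd hKloc
    have hc : 0 ≤ ∑ Y ∈ polys (L ^ k) Z, (∏ _B ∈ blocks (L ^ k) (Z \ Y),
        8 * Real.exp (1 / 4) * hamNorm (fieldWt h (L : ℝ) d k) ((L : ℝ) ^ k) (L ^ (d * k)) H) *
        ∏ Z' ∈ components Y, C * P.aFactor k Z' := by
      refine sum_nonneg fun Y _ => mul_nonneg (prod_nonneg fun _ _ => ?_) (prod_nonneg fun Z' _ => ?_)
      · have := hamNorm_nonneg h𝔥.le hRk.le (L ^ (d * k)) H; positivity
      · exact mul_nonneg hC (WeakNormLE.aFactor_pos hA k Z').le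
    exact integrable_comp_add_of_tayNormLE hb hc (contDiff_polyP2 (L ^ k) H hKd Z)
      (isGaugeLocal_polyP2_abkm (p := p) (r₀ := r₀) (θbar := θbar) (A := A) (δ := schedDelta δ₀ δ₁ N) (𝒞 := 𝒞)
        (N := N) (Mord := Mord) (R := R) hLodd hM hk hh hp H hKfac hK0 hKloc hZ)
      (hS.weightSectionDominated hB.dominated Z (P.gauge k Z)) φ
  -- (6.34) reblocked
  have hsum := nextK_freeHt_eq_sum ⟨L ^ k, L, 𝒸, c₀, B₀⟩ H Ht K U φ hint
  simp only at hsum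
  rw [hsum]
  -- abbreviations
  set T := (polys (L ^ k) univ).filter (fun X => reblock (L ^ k) (L * L ^ k) X = U) with hT
  set t : Finset (Fin d → ZMod M) → Finset (Fin d → ZMod M) → ℂ := fun X X₁ =>
    bprod (L ^ k) (fun B => expNegH Ht B φ) (U \ X) * bprod (L ^ k) (fun B => expNegH (-Ht) B φ) (X \ U) *
      (bprod (L ^ k) (fun B => 1 - expNegH Ht B φ) X₁ * fluct 𝒸 (polyP2 (L ^ k) H K (X \ X₁)) φ) with ht
  -- every `X ∈ T` is a non-empty `k`-polymer
  have hTp : ∀ X ∈ T, IsPolymer (L ^ k) X := fun X hX => (mem_polys.1 (mem_filter.1 hX).1).2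
  have hTne : ∀ X ∈ T, X.Nonempty := by
    intro X hX
    rw [nonempty_iff_ne_empty]
    intro h0
    have hXU := (mem_filter.1 hX).2
    rw [h0, reblock_empty] at hXU
    exact hUne.ne_empty hXU.symm
  -- inner split `𝓟_k(X) = {∅, X} ⊔ (𝓟_k(X) ∖ {X, ∅})`
  have hinner : ∀ X ∈ T, ∑ X₁ ∈ polys (L ^ k) X, t X X₁ =
      (∑ X₁ ∈ ({∅, X} : Finset (Finset (Fin d → ZMod M))), t X X₁) +
        ∑ X₁ ∈ ((polys (L ^ k) X).erase X).erase ∅, t X X₁ := by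
    intro X hX
    have hXne : (∅ : Finset (Fin d → ZMod M)) ≠ X := (hTne X hX).ne_empty.symm
    have hXm : X ∈ polys (L ^ k) X := self_mem_polys (hTp X hX)
    have h0m : (∅ : Finset (Fin d → ZMod M)) ∈ (polys (L ^ k) X).erase X :=
      mem_erase.2 ⟨hXne, empty_mem_polys _ _⟩
    rw [← add_sum_erase _ _ hXm, ← add_sum_erase _ _ h0m, sum_pair hXne]
    ring
  rw [sum_congr rfl hinner, sum_add_distrib]
  -- the outer three-way split of the `{∅, X}`-part
  have hthree := sum_filter_reblock_eq_three ⟨L ^ k, L, 𝒸, c₀, B₀⟩ hMo hsodd hLodd U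
    (fun X => ∑ X₁ ∈ ({∅, X} : Finset (Finset (Fin d → ZMod M))), t X X₁)
  simp only at hthree
  have hbpi : blockPartIndex (⟨L ^ k, L, 𝒸, c₀, B₀⟩ : StepData d M) U =
      (blocks (L ^ k) univ).filter (fun B => TorusPolymer.closure (L * L ^ k) B = U) := rfl
  rw [hbpi] at hthree
  rw [hthree]
  -- on `T₂`, `T₃` the pair `X₁ ∈ {∅, X}` sums to `p_X (R P₂(X) + (1 − e^{−H̃})^X)`
  have hpair : ∀ X ∈ T, ∑ X₁ ∈ ({∅, X} : Finset (Finset (Fin d → ZMod M))), t X X₁ =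
      bprod (L ^ k) (fun B => expNegH Ht B φ) (U \ X) * bprod (L ^ k) (fun B => expNegH (-Ht) B φ) (X \ U) *
        (fluct 𝒸 (polyP2 (L ^ k) H K X) φ + bprod (L ^ k) (fun B => 1 - expNegH Ht B φ) X) := by
    intro X hX
    rw [sum_pair (hTne X hX).ne_empty.symm]
    simp only [ht, bprod_empty, sdiff_empty, Finset.sdiff_self, polyP2_empty _ _ hK0, fluct_const]
    ring
  have hT₂T : largePartIndex (L ^ k) L U ⊆ T := by
    intro X hX
    obtain ⟨hXp, -, -, hXU⟩ := mem_largePartIndex.1 hX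
    exact mem_filter.2 ⟨mem_polys.2 ⟨subset_univ _, hXp⟩, hXU⟩
  have hT₃T : T.filter (fun X => ¬ IsConn X) ⊆ T := filter_subset _ _
  rw [sum_congr rfl fun X hX => hpair X (hT₂T hX), sum_congr rfl fun X hX => hpair X (hT₃T hX)]

end Literature.MathematicalPhysics.StatisticalMechanics.GradientRG

end
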